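import Literature.IUT.HodgeArakelov.EtaleThetaDataPiYddNormal
import Literature.IUT.HodgeArakelov.EtaleThetaDataOfSetting
import Literature.IUT.HodgeArakelov.ModelDef11Output
import Literature.IUT.HodgeArakelov.MonoThetaCor110SubdagStatements
import Literature.IUT.HodgeArakelov.TemperedCurveXuu
import Literature.IUT.HodgeTheaters.StableCurveTemperedDataOfSpecialFibre
import HarnessLib

/-!
# [IUTchII] Prop 2.2 (i)′: the IDENTIFICATION BINDERS of the (i)′ closers, instantiated at the GENUINE data
# («PROP22i-IDENT-GENUINE»: the [IUTchI] §2 datum of the tempered curve `X̲̲_v`, the genuine environment of bridge B8)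

S. Mochizuki, *Inter-universal Teichmüller theory II*, kurims manuscript (Dec. 2020), §2 Prop. 2.2 (i) p. 66 l. 27–35
(«`Π_{v•} ⊆ Π_{v▶} ⊆ Π_v` … the decomposition groups determined, respectively, by the subgraphs `Γ•_X` and `Γ▶_X` — i.e.,
more precisely, the group “`Π^tp_{X,ℍ}`” of [IUTchI], Corollary 2.3, (iii)»), l. 38–42 («`Π_{v▶} ⊆ Π^tp_{Y_v} ∩ Π_v = Π^tp_{Y̲_v}`»);
*Inter-universal Teichmüller theory I* (May 2020) §2 Cor. 2.3 (i)/(iii) p. 47, Def. 3.1 (e) p. 62 [claim: Mochizuki2012,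
status: disputed] (D-0012 claim key; NOTHING of the series is asserted here); [EtTh] §2 Def. 2.5 (i) p. 39, Rmk. 2.3.1 p. 38
(`Π^tp_X̲̲ ≤ Π^tp_X` open of index `l²`, onto `G_K`) [cite: MochizukiEtTh2009, Def 2.5 (i) p.39]; [SemiAnbd] §6 pp. 69–71
[cite: MochizukiSemiAnbd2006, §6 pp.69-71].

abc-iut cell, layer L6, PROOF-ONLY companion (0 `def` / `instance` / `structure`; seat abc-iut-w6-d005 gen 3, by-name row
«PROP22i-IDENT-GENUINE» of abc-iut-L6-lead §F 2026-08-26T08:58:27Z / GO 09:22:51Z; B15 first refusal declined by abc-iut-w5-d132 g4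
09:06:47Z).  DAG node **IUTchII:Prop2.2(i)**; NV register row «`SubgraphReference` / Prop 2.2 (i) MERGE identification» (was
NV-BLOCKED, `SubgraphReferenceNonVacuity.lean` p419232).  Every (i)′ closer of record — abc-iut-w5-d086's
`prop22_i'_of_cor23iii_bridge` / `prop22_i'_of_outer_bridge` (p413787) and their `hN`-free forms `…_of_ident` (p429988) — takes the
reference pair through FIVE identification binders `(C : StableCurveTemperedData) (j : C.PiTp ≃ₜ* S.PiX) (e₀ : P ≃ₜ* S.PiX)
(hbullet : R.refBullet = C.piTpXH.map j) (hker : E.recon.projG (E.isoX y) = 1 ↔ C.prTp (j.symm (e₀ y)) = 1)`.  HERE they are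
INSTANTIATED at genuine data, consuming BY NAME (nothing restated): abc-iut-L5's `StableCurveTemperedData.ofSpecialFibre`
(p-landed bridge L3 → L5), abc-iut-L6-t7's `TemperedCurve.ofOpenSubgroup` (B15 piece 1, p432410) at `H := Π^tp_X̲̲ = C.Huu`
(abc-iut-L2-t8's `DoubleUnderline`: `isOpen_Huu`, `index_Huu = l²`, `map_aug_Huu = G_K`), abc-iut-L6-d6's B8 part 6
`ThetaSetting.envOfGroup` (ModelDef11Output) re-based by `EnvOfGroup.transportAlong` (MonoThetaCor110SubdagStatements), and the
abc-iut-w5-d072 convention (`PointedInversionOfSetting`): the environment `Env` stays ABSTRACT and its Galois kernel is spoken of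
only through `Env.recon.projG ∘ Env.isoX`.

WHAT IS PROVED.
* §1 (any tempered curve `X'` with an identification `i : Π^temp_{X'} ≃ₜ* Π_v` over the augmentations, `haug`):
  `projG_isoX_eq_one_iff_prTp_ofSpecialFibre` — the binder `hker` is DERIVED from the ONE identification datum
  `hEnv : ∀ y, Env.recon.projG (Env.isoX y) = 1 ↔ D.aug y = 1` («`Ker(Π_v ≅ Π_X(M^Θ(Π_v)) ↠ G) = Δ^tp_{X̲̲_v}`»; the SAME datum
  abc-iut-w4-d010 g6 names for «P22i-IOTA-FUNCTORIAL» v2 — the seam between the two pieces) at `C := ofSpecialFibre X' …`,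
  `j := i ≫ eS`, `e₀ := eS`; hence (SJ) `SubgraphReference.exists_mem_refBullet_ofSpecialFibre_of_outer / _of_cor23iii` and
  **`prop22_i'_ofSpecialFibre_of_outer / _of_cor23iii` : `Prop22_i' R T D' ι₀`** from {`hG` = F-1782 `GroupTheoretic` (vocabulary
  predicate, the printed proof's [SemiAnbd] Cor. 3.11 input), `hbullet`, `hEnv`, `hOut` («`ℍ` is `G_K`-stable», [IUTchII] Rmk. 2.1.1 (ii)
  / [IUTchI] Cor. 2.3 (i)) resp. the typed `Cor23iii` + `Cor23Hyp`}; and `SubgraphReference.exists_refTri_refBullet_eq` — a reference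
  pair WITH `refBullet = j(Π^tp_{X,ℍ})` exists under the printed placement «`Π_{v▶} ⊆ Π^tp_{Y̲_v}`» (p. 66 l. 38–42; binders `hQ`, `hQY`).
* §2 (the GENUINE curve `X̲̲_v`): abc-iut-L6-t7's `temperedCurveXuuOfLevelData` / `groupLevelDataXuu` (B15 piece 1b′,
  `TemperedCurveXuu.lean`: `TemperedCurve.ofOpenSubgroup` at `H := C.Huu`, openness of the decomposition groups discharged from the
  parameter bundle; its `Π^temp` IS `Pi C` and its augmentation IS `D.aug`, definitionally, so `i := refl`, `haug := rfl`):
  **`prop22_i'_xuu_of_outer`** — `Prop22_i'` at the genuine curve from {`hG`, `hbullet`, `hEnv`, `hOut`, special-fibre DATA}.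
* §3 (the GENUINE environment, generic part): `ThetaSetting.projG_isoX_envOfGroup_transportAlong_eq_one_iff` — for B8 part 6's
  `envOfGroup R X …` re-based along its own `isoX` by `EnvOfGroup.transportAlong` (so that Prop. 1.2 (i)'s functorial isomorphism
  `Π ⥲ Π_X(M^Θ(Π))` is the identity; the record's own `isoX := Nonempty.some _` is an unnamed choice about which nothing can be
  proved), `projG (isoX y) = 1 ↔ R.aug y = 1`.  The Tate-curve instantiation (`C.rigidData`: this IS `hEnv`), the fully genuine closer
  at `S := ofUnderline` and the ∃-witness of all five binders are the sequel file `SubgraphReferenceGenuineIdentificationTate.lean`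
  (they take the §1–2 named inputs `hC : D.Compat`, `hS : D.Sec2Hyps`, F-0591 `Prop15iii` of the [EtTh] stack as hypotheses).

HONEST BINDER CENSUS (what is NOT discharged, all print-shaped DATA/inputs, no `Prop` smuggled): the special-fibre data of `X̲̲_v`
(`d`, `Sf`, `h36`, `Σ ⊆ Σ̂`, `Π_ℍ := TpH` for `ℍ := Γ•_X`, `HatH`, `hle`, `cuspMeetsH` — nobody constructs the dual graph of the special
fibre of the [EtTh] model; abc-iut-L3's `SpecialFibreOrigin` lane), the parameter bundle `d₀` of `X_v` (in §2 the printed openness of the decomposition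
groups of `X̲̲_v`, [SemiAnbd] §6 p. 71, is discharged from it inside `temperedCurveXuuOfLevelData`), `hOut` / `Cor23iii`, `hbullet` (the CHOICE `Π_{v•} := j(Π^tp_{X,Γ•})`, abc-iut-w5-d132's reading — or
`∃ R` under `hQ`/`hQY`), `hG` (F-1782).  Typed ≠ proved for those; witnessed ≠ discharged; no side is
taken on [IUTchIII] Cor. 3.12; nothing here asserts that the printed reconstruction algorithms exist.
-/

noncomputable section

namespace Literature.IUT.HodgeArakelov

open Literature.AnabelianGeometry.EtaleTheta Literature.AnabelianGeometry.SemiGraphs Literature.IUT.HodgeTheaters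
open EtaleThetaDataOfSetting
open scoped Pointwise

variable {p : ℕ} [Fact p.Prime] {D : Literature.AnabelianGeometry.EtaleTheta.ThetaSetting p}
  {E : D.EtaleThetaData} {l : ℕ} (C : E.DoubleUnderline l)

/-! ### §1. Any tempered curve `X'` whose `Π^temp` is identified with `Π_v = Π^tp_X̲̲` over the augmentations -/

section Generic

variable (S : BadPlaceSetting.{0}) (eS : (Pi C) ≃ₜ* S.PiX) (Env : EnvOfGroup S.toThetaSetting (Pi C))
  (hEnv : ∀ y : Pi C, Env.recon.projG (Env.isoX y) = 1 ↔ D.aug (y : D.PiTemp) = 1)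
  (X' : TemperedCurve p) (i : X'.PiTemp ≃ₜ* (Pi C))
  (haug : ∀ g : X'.PiTemp, X'.aug g = D.aug ((i g : Pi C) : D.PiTemp))
  (d : X'.GroupLevelData) (Sf : SpecialFibreData (X'.toTemperedArithmeticGroup d))
  (h36 : Sf.Gc.Prop36Hypotheses) (Sigma SigmaHat : Set ℕ) (hsub : Sigma ⊆ SigmaHat) (hne : Sigma.Nonempty)
  (hprime : ∀ q ∈ SigmaHat, q.Prime) (hp : p ∉ Sigma) (TpH : Subgroup Sf.chart.G)
  (HatH : Subgroup (TemperedGraphGroupData.exists_completion_of_prop36 Sf.Gc h36 Sf.chart).choose)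
  (hle : TpH.map (TemperedGraphGroupData.exists_completion_of_prop36 Sf.Gc h36
    Sf.chart).choose_spec.choose.toMonoidHom ≤ HatH)
  (cuspMeetsH : {x : X'.Pt // X'.IsCusp x} → Prop)

include hEnv haug in
/-- **The binder `hker` DERIVED** at abc-iut-L5's genuine [IUTchI] §2 datum `ofSpecialFibre X' …` of a tempered curve `X'`
whose `Π^temp` is identified with `Π_v = Π^tp_X̲̲` by `i` over the augmentations (`haug`), from the one identification datum
`hEnv` («`Ker(Π_v ≅ Π_X(M^Θ(Π_v)) ↠ G) = Δ^tp_{X̲̲_v}`»): with `j := i ≫ eS`, `e₀ := eS`, the kernel of `Env.recon.projG ∘ Env.isoX` IS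
the kernel of `Π^tp_X ↠ G_k` of the datum. [claim: Mochizuki2012, status: disputed] (IUTchII §2 Prop 2.2 (i), kurims p.66; IUTchI §2 Cor 2.3 (iii), kurims p.47) -/
theorem projG_isoX_eq_one_iff_prTp_ofSpecialFibre (y : Pi C) :
    Env.recon.projG (Env.isoX y) = 1 ↔
      (StableCurveTemperedData.ofSpecialFibre X' d Sf h36 Sigma SigmaHat hsub hne hprime hp TpH HatH hle
          cuspMeetsH).prTp ((i.trans eS).symm (eS y)) = 1 := by
  rw [hEnv]
  have h1 : (i.trans eS).symm (eS y) = i.symm y := by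
    apply (i.trans eS).injective
    rw [ContinuousMulEquiv.apply_symm_apply, ContinuousMulEquiv.trans_apply, ContinuousMulEquiv.apply_symm_apply]
  rw [h1]
  change _ ↔ X'.augGK (i.symm y) = 1
  rw [← OneMemClass.coe_eq_one, TemperedCurve.coe_augGK_apply, haug, ContinuousMulEquiv.apply_symm_apply]

include hEnv haug in
/-- **(SJ) «`Π_{v•}·Δ = Π_v`» at the genuine datum, from outer descent** («`ℍ = Γ•_X` is `G_K`-stable», [IUTchII] Rmk. 2.1.1 (ii);
the slimness-free route of abc-iut-w4-d058's `piTpXH_surjective_of_outer` via abc-iut-w5-d086's `exists_mem_refBullet_of_outer`):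
the hypothesis `hsurj` of `prop22_i'_of_groupTheoretic(_of_surj)` / `prop22_i'_etaleThetaDataOfSetting` for every reference pair `R`
whose `Π_{v•}` is `j(Π^tp_{X,ℍ})` (`hbullet`). [claim: Mochizuki2012, status: disputed] (IUTchII §2 Prop 2.2 (i), kurims p.66; IUTchI §2 Cor 2.3 (i)(iii), kurims p.47) -/
theorem SubgraphReference.exists_mem_refBullet_ofSpecialFibre_of_outer (R : SubgraphReference S)
    (hbullet : R.refBullet =
      (StableCurveTemperedData.ofSpecialFibre X' d Sf h36 Sigma SigmaHat hsub hne hprime hp TpH HatH hle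
          cuspMeetsH).piTpXH.map (i.trans eS).toMulEquiv.toMonoidHom)
    (hOut : ∀ g : (StableCurveTemperedData.ofSpecialFibre X' d Sf h36 Sigma SigmaHat hsub hne hprime hp TpH HatH hle
          cuspMeetsH).PiTp,
      ∃ δ : (StableCurveTemperedData.ofSpecialFibre X' d Sf h36 Sigma SigmaHat hsub hne hprime hp TpH HatH hle
          cuspMeetsH).DeltaTp,
        MulAut.conj g • ((StableCurveTemperedData.ofSpecialFibre X' d Sf h36 Sigma SigmaHat hsub hne hprime hp TpH
              HatH hle cuspMeetsH).deltaTpH.map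
            (StableCurveTemperedData.ofSpecialFibre X' d Sf h36 Sigma SigmaHat hsub hne hprime hp TpH HatH hle
              cuspMeetsH).DeltaTp.subtype) =
          MulAut.conj (δ : (StableCurveTemperedData.ofSpecialFibre X' d Sf h36 Sigma SigmaHat hsub hne hprime hp
              TpH HatH hle cuspMeetsH).PiTp) •
            ((StableCurveTemperedData.ofSpecialFibre X' d Sf h36 Sigma SigmaHat hsub hne hprime hp TpH HatH hle
                cuspMeetsH).deltaTpH.map
              (StableCurveTemperedData.ofSpecialFibre X' d Sf h36 Sigma SigmaHat hsub hne hprime hp TpH HatH hle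
                cuspMeetsH).DeltaTp.subtype)) :
    ∃ e₀ : (Pi C) ≃ₜ* S.PiX, ∀ x : Pi C, ∃ b : Pi C, e₀ b ∈ R.refBullet ∧
      Env.recon.projG (Env.isoX b) = Env.recon.projG (Env.isoX x) :=
  R.exists_mem_refBullet_of_outer (E := Env) _ (i.trans eS) eS hbullet
    (projG_isoX_eq_one_iff_prTp_ofSpecialFibre C S eS Env hEnv X' i haug d Sf h36 Sigma SigmaHat hsub hne hprime
      hp TpH HatH hle cuspMeetsH) hOut

include hEnv haug in
/-- **(SJ) at the genuine datum, from the typed [IUTchI] Cor. 2.3 (iii)** (abc-iut-L5-t1's `Cor23iii` under its hypothesis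
(a)/(b) `Cor23Hyp` — in the IUT application `Σ = {l}`, `Σ̂ = Primes`), via abc-iut-w5-d086's `exists_mem_refBullet_of_cor23iii`.
[claim: Mochizuki2012, status: disputed] (IUTchII §2 Prop 2.2 (i), kurims p.66; IUTchI §2 Cor 2.3 (iii), kurims p.47) -/
theorem SubgraphReference.exists_mem_refBullet_ofSpecialFibre_of_cor23iii (R : SubgraphReference S)
    (hbullet : R.refBullet =
      (StableCurveTemperedData.ofSpecialFibre X' d Sf h36 Sigma SigmaHat hsub hne hprime hp TpH HatH hle
          cuspMeetsH).piTpXH.map (i.trans eS).toMulEquiv.toMonoidHom)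
    (h23 : (StableCurveTemperedData.ofSpecialFibre X' d Sf h36 Sigma SigmaHat hsub hne hprime hp TpH HatH hle
          cuspMeetsH).Cor23iii)
    (hyp : (StableCurveTemperedData.ofSpecialFibre X' d Sf h36 Sigma SigmaHat hsub hne hprime hp TpH HatH hle
          cuspMeetsH).Cor23Hyp) :
    ∃ e₀ : (Pi C) ≃ₜ* S.PiX, ∀ x : Pi C, ∃ b : Pi C, e₀ b ∈ R.refBullet ∧
      Env.recon.projG (Env.isoX b) = Env.recon.projG (Env.isoX x) :=
  R.exists_mem_refBullet_of_cor23iii (E := Env) _ (i.trans eS) eS hbullet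
    (projG_isoX_eq_one_iff_prTp_ofSpecialFibre C S eS Env hEnv X' i haug d Sf h36 Sigma SigmaHat hsub hne hprime
      hp TpH HatH hle cuspMeetsH) h23 hyp

include hEnv haug in
/-- **IUTchII:Prop2.2(i)′ with the identification binders `C`, `j`, `e₀`, `hker` DISCHARGED at the genuine datum** (outer-descent
route): `Prop22_i' R T D' ι₀` for every Prop. 2.1 output `T`, Prop. 1.4 output `D'` and pointed inversion `ι₀` over `Env`, from
`hG` (F-1782, the printed proof's [SemiAnbd] Cor. 3.11 input), `hbullet` (the choice `Π_{v•} := j(Π^tp_{X,Γ•})`), `hEnv` and `hOut`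
— abc-iut-w5-d086's `prop22_i'_of_outer_bridge` in its `hN`-free form (p429988) with `C := ofSpecialFibre X' …`, `j := i ≫ eS`,
`e₀ := eS`. [claim: Mochizuki2012, status: disputed] (IUTchII §2 Prop 2.2 (i), kurims pp.66-67; IUTchI §2 Cor 2.3 (i)(iii), kurims p.47) -/
theorem prop22_i'_ofSpecialFibre_of_outer (R : SubgraphReference S) (T : TemperedCoverings S (Pi C))
    (D' : EtaleThetaData S.toThetaSetting (Pi C)) (ι₀ : PointedInversion Env D') (hG : R.GroupTheoretic)
    (hbullet : R.refBullet =
      (StableCurveTemperedData.ofSpecialFibre X' d Sf h36 Sigma SigmaHat hsub hne hprime hp TpH HatH hle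
          cuspMeetsH).piTpXH.map (i.trans eS).toMulEquiv.toMonoidHom)
    (hOut : ∀ g : (StableCurveTemperedData.ofSpecialFibre X' d Sf h36 Sigma SigmaHat hsub hne hprime hp TpH HatH hle
          cuspMeetsH).PiTp,
      ∃ δ : (StableCurveTemperedData.ofSpecialFibre X' d Sf h36 Sigma SigmaHat hsub hne hprime hp TpH HatH hle
          cuspMeetsH).DeltaTp,
        MulAut.conj g • ((StableCurveTemperedData.ofSpecialFibre X' d Sf h36 Sigma SigmaHat hsub hne hprime hp TpH
              HatH hle cuspMeetsH).deltaTpH.map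
            (StableCurveTemperedData.ofSpecialFibre X' d Sf h36 Sigma SigmaHat hsub hne hprime hp TpH HatH hle
              cuspMeetsH).DeltaTp.subtype) =
          MulAut.conj (δ : (StableCurveTemperedData.ofSpecialFibre X' d Sf h36 Sigma SigmaHat hsub hne hprime hp
              TpH HatH hle cuspMeetsH).PiTp) •
            ((StableCurveTemperedData.ofSpecialFibre X' d Sf h36 Sigma SigmaHat hsub hne hprime hp TpH HatH hle
                cuspMeetsH).deltaTpH.map
              (StableCurveTemperedData.ofSpecialFibre X' d Sf h36 Sigma SigmaHat hsub hne hprime hp TpH HatH hle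
                cuspMeetsH).DeltaTp.subtype)) :
    Prop22_i' R T D' ι₀ :=
  prop22_i'_of_outer_bridge_of_ident R T D' ι₀ hG _ (i.trans eS) eS hbullet
    (projG_isoX_eq_one_iff_prTp_ofSpecialFibre C S eS Env hEnv X' i haug d Sf h36 Sigma SigmaHat hsub hne hprime
      hp TpH HatH hle cuspMeetsH) hOut

include hEnv haug in
/-- **IUTchII:Prop2.2(i)′ with `C`, `j`, `e₀`, `hker` DISCHARGED at the genuine datum** (typed [IUTchI] Cor. 2.3 (iii) route):
as `prop22_i'_ofSpecialFibre_of_outer`, with `hOut` replaced by abc-iut-L5-t1's `Cor23iii` + `Cor23Hyp` of the datum.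
[claim: Mochizuki2012, status: disputed] (IUTchII §2 Prop 2.2 (i), kurims pp.66-67; IUTchI §2 Cor 2.3 (iii), kurims p.47) -/
theorem prop22_i'_ofSpecialFibre_of_cor23iii (R : SubgraphReference S) (T : TemperedCoverings S (Pi C))
    (D' : EtaleThetaData S.toThetaSetting (Pi C)) (ι₀ : PointedInversion Env D') (hG : R.GroupTheoretic)
    (hbullet : R.refBullet =
      (StableCurveTemperedData.ofSpecialFibre X' d Sf h36 Sigma SigmaHat hsub hne hprime hp TpH HatH hle
          cuspMeetsH).piTpXH.map (i.trans eS).toMulEquiv.toMonoidHom)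
    (h23 : (StableCurveTemperedData.ofSpecialFibre X' d Sf h36 Sigma SigmaHat hsub hne hprime hp TpH HatH hle
          cuspMeetsH).Cor23iii)
    (hyp : (StableCurveTemperedData.ofSpecialFibre X' d Sf h36 Sigma SigmaHat hsub hne hprime hp TpH HatH hle
          cuspMeetsH).Cor23Hyp) :
    Prop22_i' R T D' ι₀ :=
  prop22_i'_of_cor23iii_bridge_of_ident R T D' ι₀ hG _ (i.trans eS) eS hbullet
    (projG_isoX_eq_one_iff_prTp_ofSpecialFibre C S eS Env hEnv X' i haug d Sf h36 Sigma SigmaHat hsub hne hprime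
      hp TpH HatH hle cuspMeetsH) h23 hyp

/-- **A reference pair WITH `Π_{v•} = j(Π^tp_{X,ℍ})` exists** under the printed placement «`Π_{v▶} ⊆ Π^tp_{Y_v} ∩ Π_v = Π^tp_{Y̲_v}`»
(kurims p. 66 l. 38–42): for any `Π_{v▶} := Q` between `j(Π^tp_{X,ℍ})` and the pull-back of `Π^tp_{Y_v}` (binders `hQ`, `hQY` — the
decomposition group of the [simply connected] subgraph `Γ▶_X ⊇ Γ•_X` lifted to `Y̲_v`), the interface `SubgraphReference S` is inhabited
with `refTri = Q`, `refBullet = j(Π^tp_{X,ℍ})` — so `hbullet` is a satisfiable DATUM, not a constraint on `S`.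
[claim: Mochizuki2012, status: disputed] (IUTchII §2 Prop 2.2 (i), kurims p.66) -/
theorem SubgraphReference.exists_refTri_refBullet_eq (Q : Subgroup S.PiX)
    (hQ : (StableCurveTemperedData.ofSpecialFibre X' d Sf h36 Sigma SigmaHat hsub hne hprime hp TpH HatH hle
          cuspMeetsH).piTpXH.map (i.trans eS).toMulEquiv.toMonoidHom ≤ Q)
    (hQY : Q ≤ S.refY.comap S.inclPlain) :
    ∃ R : SubgraphReference S, R.refTri = Q ∧ R.refBullet =
      (StableCurveTemperedData.ofSpecialFibre X' d Sf h36 Sigma SigmaHat hsub hne hprime hp TpH HatH hle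
          cuspMeetsH).piTpXH.map (i.trans eS).toMulEquiv.toMonoidHom :=
  ⟨{ refTri := Q, refBullet := _, refBullet_le := hQ, refTri_le_Y := hQY }, rfl, rfl⟩

end Generic

/-! ### §2. The genuine curve `X̲̲_v` (abc-iut-L6-t7's `temperedCurveXuuOfLevelData`, B15 piece 1b′, `TemperedCurveXuu.lean`) -/

section Xuu

/-- **IUTchII:Prop2.2(i)′ at the GENUINE curve `X̲̲_v`** — abc-iut-L6-t7's `temperedCurveXuuOfLevelData` ([SemiAnbd] §6 / [IUTchI] Def 3.1 (e):
`TemperedCurve.ofOpenSubgroup` at the open index-`l²` subgroup `Π^tp_X̲̲ = C.Huu ≤ Π^tp_X` with base field `K`, the openness of the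
decomposition groups discharged from the parameter bundle `d₀`; its `Π^temp` IS `Pi C` and its augmentation IS `D.aug`, definitionally, so
`i := refl`, `haug := rfl`), with abc-iut-L5's [IUTchI] §2 datum over the induced bundle `groupLevelDataXuu`: `Prop22_i' R T D' ι₀` from `hG`,
`hbullet`, `hEnv`, `hOut` and the special-fibre DATA of `X̲̲_v` (outer-descent route; the Cor. 2.3 (iii) route is
`prop22_i'_ofSpecialFibre_of_cor23iii` at the same curve). [claim: Mochizuki2012, status: disputed] (IUTchII §2 Prop 2.1/2.2 (i), kurims pp.64-67; IUTchI §2 Cor 2.3, kurims p.47) -/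
theorem prop22_i'_xuu_of_outer (S : BadPlaceSetting.{0}) (eS : (Pi C) ≃ₜ* S.PiX)
    (Env : EnvOfGroup S.toThetaSetting (Pi C))
    (hEnv : ∀ y : Pi C, Env.recon.projG (Env.isoX y) = 1 ↔ D.aug (y : D.PiTemp) = 1)
    (d₀ : D.toTemperedCurve.GroupLevelData)
    (Sf : SpecialFibreData ((C.temperedCurveXuuOfLevelData C.l_ne_zero d₀).toTemperedArithmeticGroup
      (C.groupLevelDataXuu C.l_ne_zero d₀)))
    (h36 : Sf.Gc.Prop36Hypotheses) (Sigma SigmaHat : Set ℕ) (hsub : Sigma ⊆ SigmaHat) (hne : Sigma.Nonempty)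
    (hprime : ∀ q ∈ SigmaHat, q.Prime) (hp : p ∉ Sigma) (TpH : Subgroup Sf.chart.G)
    (HatH : Subgroup (TemperedGraphGroupData.exists_completion_of_prop36 Sf.Gc h36 Sf.chart).choose)
    (hle : TpH.map (TemperedGraphGroupData.exists_completion_of_prop36 Sf.Gc h36
      Sf.chart).choose_spec.choose.toMonoidHom ≤ HatH)
    (cuspMeetsH : {x : (C.temperedCurveXuuOfLevelData C.l_ne_zero d₀).Pt //
      (C.temperedCurveXuuOfLevelData C.l_ne_zero d₀).IsCusp x} → Prop)
    (R : SubgraphReference S) (T : TemperedCoverings S (Pi C))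
    (D' : EtaleThetaData S.toThetaSetting (Pi C)) (ι₀ : PointedInversion Env D') (hG : R.GroupTheoretic)
    (hbullet : R.refBullet =
      (StableCurveTemperedData.ofSpecialFibre _ (C.groupLevelDataXuu C.l_ne_zero d₀) Sf h36 Sigma SigmaHat hsub hne
          hprime hp TpH HatH hle cuspMeetsH).piTpXH.map ((ContinuousMulEquiv.refl (Pi C)).trans eS).toMulEquiv.toMonoidHom)
    (hOut : ∀ g : (StableCurveTemperedData.ofSpecialFibre _ (C.groupLevelDataXuu C.l_ne_zero d₀) Sf h36 Sigma SigmaHat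
          hsub hne hprime hp TpH HatH hle cuspMeetsH).PiTp,
      ∃ δ : (StableCurveTemperedData.ofSpecialFibre _ (C.groupLevelDataXuu C.l_ne_zero d₀) Sf h36 Sigma SigmaHat
          hsub hne hprime hp TpH HatH hle cuspMeetsH).DeltaTp,
        MulAut.conj g • ((StableCurveTemperedData.ofSpecialFibre _ (C.groupLevelDataXuu C.l_ne_zero d₀) Sf h36 Sigma
              SigmaHat hsub hne hprime hp TpH HatH hle cuspMeetsH).deltaTpH.map
            (StableCurveTemperedData.ofSpecialFibre _ (C.groupLevelDataXuu C.l_ne_zero d₀) Sf h36 Sigma SigmaHat hsub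
              hne hprime hp TpH HatH hle cuspMeetsH).DeltaTp.subtype) =
          MulAut.conj (δ : (StableCurveTemperedData.ofSpecialFibre _ (C.groupLevelDataXuu C.l_ne_zero d₀) Sf h36 Sigma
              SigmaHat hsub hne hprime hp TpH HatH hle cuspMeetsH).PiTp) •
            ((StableCurveTemperedData.ofSpecialFibre _ (C.groupLevelDataXuu C.l_ne_zero d₀) Sf h36 Sigma SigmaHat hsub
                hne hprime hp TpH HatH hle cuspMeetsH).deltaTpH.map
              (StableCurveTemperedData.ofSpecialFibre _ (C.groupLevelDataXuu C.l_ne_zero d₀) Sf h36 Sigma SigmaHat hsub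
                hne hprime hp TpH HatH hle cuspMeetsH).DeltaTp.subtype)) :
    Prop22_i' R T D' ι₀ :=
  prop22_i'_ofSpecialFibre_of_outer C S eS Env hEnv _ (ContinuousMulEquiv.refl (Pi C)) (fun _ => rfl) _ Sf h36
    Sigma SigmaHat hsub hne hprime hp TpH HatH hle cuspMeetsH R T D' ι₀ hG hbullet hOut

end Xuu

/-! ### §3. The identification datum `hEnv` at the GENUINE environment of bridge B8 -/

section GenuineEnv

universe u

/-- **`Ker(Π ≅ Π_X(M^Θ(Π)) ↠ G(M^Θ(Π))) = Ker(aug)` for B8 part 6's `envOfGroup` RE-BASED along its own `isoX`** (generic rigidity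
interface `R`; `EnvOfGroup.transportAlong`, C110-S7): the re-based Prop. 1.2 (i) output over `Π_X(M^Θ(Π)) = Π^tp_X` has the identity as
its functorial isomorphism and `Π_X(M^Θ(Π)) ↠ G(M^Θ(Π))` is `QuotientGroup.mk' (Ker aug)` (abc-iut-L6-d6's `ModelFrame.reconstruction`),
so its Galois kernel is `Ker(aug)` on the nose.  (The record's own `isoX := Nonempty.some _` is an unnamed choice, about which nothing can
be proved; the re-base is the honest fix.) [claim: Mochizuki2012, status: disputed] (IUTchII §1 Prop 1.2 (i), kurims p.25) -/
theorem ThetaSetting.projG_isoX_envOfGroup_transportAlong_eq_one_iff {N : ℕ+} {l' : ℕ} (R : RigidData.{u} N l')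
    [TopologicalSpace R.G] [IsTopologicalGroup R.G] (X : ThetaSetting.SideData R.toThetaEnvData) (h1 : T1Space R.PiX)
    (h2 : IsClosed (((R.aug.ker : Subgroup R.PiX)) : Set R.PiX))
    (h3 : Nonempty (ModelCyclotomes.lDeltaQuot R ≃* Literature.IUT.HodgeTheaters.ZHat))
    (P : TopGroup.{u}) (hP : Nonempty (P ≃ₜ* (ThetaSetting.ofThetaEnvData R.toThetaEnvData X).PiX))
    (y : (ThetaSetting.envOfGroup R X h1 h2 h3 P hP).recon.PiX) :
    ((ThetaSetting.envOfGroup R X h1 h2 h3 P hP).transportAlong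
          (ThetaSetting.envOfGroup R X h1 h2 h3 P hP).isoX).recon.projG
        (((ThetaSetting.envOfGroup R X h1 h2 h3 P hP).transportAlong
          (ThetaSetting.envOfGroup R X h1 h2 h3 P hP).isoX).isoX y) = 1 ↔ R.aug y = 1 := by
  rw [EnvOfGroup.transportAlong_isoX_apply, ContinuousMulEquiv.apply_symm_apply]
  change QuotientGroup.mk' R.aug.ker y = 1 ↔ _
  rw [QuotientGroup.mk'_apply, QuotientGroup.eq_one_iff, MonoidHom.mem_ker]

end GenuineEnv


end Literature.IUT.HodgeArakelov

end
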